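/-
Origin: written from primary sources — R. Howe, *θ-series and invariant theory* (1979) §2–§3 (restriction of the oscillator
representation to a see-saw partner is the tensor of the small ones up to a character; renormalising the small ones makes it
exact); S. Kudla, *Seesaw dual reductive pairs* (1984) §1; S. Gelbart, J. Rogawski, Invent. Math. 105 (1991) §3.1 Remark
p. 457 (two splittings differ by a character trivial on rational points); A. Weil, Acta Math. 111 (1964) Chap. III n° 39,
n° 41 Thm 6. Adapted: no. This file INSTANTIATES the product-group API of `AdelicMetaplecticSeesawCharacter` (factor
characters `λ_V, λ₁, λ₂`, scheme (small) «twist the small pairs», continuity) at the splitting data of record of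
`UnitaryDualPairSeesawCharacter` / `UnitaryDualPairSeesawConjCharacter`. Kernel only; no records.
-/
import Literature.NumberTheory.GelbartRogawski1991.UnitaryDualPairSeesawConjCharacter
import Literature.NumberTheory.GelbartRogawski1991.UnitaryDualPairSeesawContinuity
import HarnessLib

/-!
# Scheme (small) at the splitting data of record: `RestrictTmul` ON THE NOSE for the renormalised small pairs

For the three compatible splittings `s, s₁, s₂` of `UnitaryDualPairSeesawCharacter` (and, for the conjugated torus, the
isometry data of `UnitaryDualPairSeesawConjCharacter`):

* §1 `pairSmall_j s_j : U(J_V)(𝔸) × U(J_j)(𝔸) →* Mp_ψ(W_{T_V ⊗ T_j})ᶜᵒⁿᵗ` — the small pair splittings read back along `e_j`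
  (`seesawSmall_j s_j = pairSmall_j s_j ∘ (id × pr_j)`, `rfl`); `seesawBigSum s` / `seesawConjSum` — the big (resp.
  conjugated) splitting moved to block-sum coordinates `(Fin N × Fin M₁) ⊕ (Fin N × Fin M₂)` by `sumSeesawSplitting`; the
  see-saw hypothesis in the product shape of `AdelicMetaplecticSeesawCharacter` (`hs₃_seesaw`, `hs₃_seesawConj`);
* §2 the FACTOR CHARACTERS `charV₁₂ : U(J_V)(𝔸) →* ℂˣ` (`g ↦ χ₁₂(g,(1,1))`), `char₁`, `char₂`, trivial on rational points
  (`charV₁₂_eq_one_of_rational`, …), continuous along continuous pair splittings (`continuous_charV₁₂`, …) — the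
  characters whose archimedean components on the compact tori are the `det^{n_b}` of the K-type normalisation;
* §3 **`restrictTmul₁₂`** — for ALL `g, u₁, u₂, Φ₁, Φ₂`:
  `ω(seesawBigSum s (g,(u₁,u₂))) (Φ₁ ⊠ Φ₂) = ω₁′(g,u₁) Φ₁ ⊠ ω₂′(g,u₂) Φ₂` with `ω_j′ := twist (charSmall_j) (ω ∘ pairSmall_j s_j)`
  — the package's `ThetaSeesawData.RestrictTmul` (big representation untouched, small ones renormalised) as a THEOREM
  about the constructed adelic Weil representations; **`restrictTmul₃₄`** — the same for the conjugated torus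
  (`seesawConjSum`), and `charV₃₄` with its rational triviality (no continuity claim there).

Provenance / use (Hodge-CM model-construction cell, rows `gen12`/`real34`, node W2-Kn): with `S := 𝒮(𝔸_F^{(N×M₁)⊕(N×M₂)})`,
`tmul := tensorToSum`, `ωW := ω ∘ seesawBigSum s` (resp. `ω ∘ seesawConjSum`), `ω_j := ω_j′` the fields `RestrictTmul`
of the package's `ThetaSeesawData` hold by `restrictTmul₁₂` / `restrictTmul₃₄`; `EvalTmul` is `boxTensor_ratPt` of
`AdelicSchwartzBruhatDirectSum`. The price of scheme (small) — the small pairs' theta kernels change by `charSmall_j` —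
is the content of node W2-Kn.
-/

set_option autoImplicit false

noncomputable section

open scoped Matrix Kronecker
open NumberField
open Literature.RepresentationTheory Literature.RepresentationTheory.SeesawScalar
open Literature.RepresentationTheory.HeisenbergGroup
open Literature.NumberTheory.Automorphic
open Literature.NumberTheory.Automorphic.UnitaryGroup
open Literature.NumberTheory.Weil1964

namespace Literature.NumberTheory.GelbartRogawski1991

namespace UnitaryDualPair

/-! ## §1 The homomorphisms in the product shape -/

section Homs

variable (F E : Type) [Field F] [NumberField F] [Field E] [NumberField E] [Algebra F E]
variable (c : E ≃ₐ[F] E) (N M₁ M₂ : ℕ) {n n₁ n₂ : ℕ}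
  (eW : Fin N × Fin (M₁ + M₂) ≃ Fin n) (e₁ : Fin N × Fin M₁ ≃ Fin n₁) (e₂ : Fin N × Fin M₂ ≃ Fin n₂)
variable (JV : Matrix (Fin N) (Fin N) E) (J₁ : Matrix (Fin M₁) (Fin M₁) E) (J₂ : Matrix (Fin M₂) (Fin M₂) E)
variable {TV : Matrix (Fin N) (Fin N) F} {T₁ : Matrix (Fin M₁) (Fin M₁) F} {T₂ : Matrix (Fin M₂) (Fin M₂) F}

/-- **the first small pair splitting read back along `e₁`**, on `U(J_V)(𝔸) × U(J₁)(𝔸)`. [folklore] -/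
def pairSmall₁ (s₁ : adelicPair F E c N M₁ JV J₁ →* adelicMpCont F (Fin n₁) (adelicGram F e₁ TV T₁)) :
    adelic F E c N JV × adelic F E c M₁ J₁ →*
      adelicMpCont F (Fin N × Fin M₁)
        (TV.map (algebraMap F (AdeleRing (𝓞 F) F)) ⊗ₖ T₁.map (algebraMap F (AdeleRing (𝓞 F) F))) :=
  (adelicMpContReindex F e₁
      (TV.map (algebraMap F (AdeleRing (𝓞 F) F)) ⊗ₖ T₁.map (algebraMap F (AdeleRing (𝓞 F) F)))).symm.toMonoidHom.comp
    (pairSplitting F E c N M₁ e₁ JV J₁ s₁)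

/-- **the second small pair splitting read back along `e₂`**, on `U(J_V)(𝔸) × U(J₂)(𝔸)`. [folklore] -/
def pairSmall₂ (s₂ : adelicPair F E c N M₂ JV J₂ →* adelicMpCont F (Fin n₂) (adelicGram F e₂ TV T₂)) :
    adelic F E c N JV × adelic F E c M₂ J₂ →*
      adelicMpCont F (Fin N × Fin M₂)
        (TV.map (algebraMap F (AdeleRing (𝓞 F) F)) ⊗ₖ T₂.map (algebraMap F (AdeleRing (𝓞 F) F))) :=
  (adelicMpContReindex F e₂
      (TV.map (algebraMap F (AdeleRing (𝓞 F) F)) ⊗ₖ T₂.map (algebraMap F (AdeleRing (𝓞 F) F)))).symm.toMonoidHom.comp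
    (pairSplitting F E c N M₂ e₂ JV J₂ s₂)

/-- `seesawSmall₁ s₁ = pairSmall₁ s₁ ∘ (id × pr₁)`. [folklore] -/
theorem seesawSmall₁_eq (s₁ : adelicPair F E c N M₁ JV J₁ →* adelicMpCont F (Fin n₁) (adelicGram F e₁ TV T₁)) :
    seesawSmall₁ F E c N M₁ M₂ e₁ JV J₁ J₂ s₁ =
      (pairSmall₁ F E c N M₁ e₁ JV J₁ s₁).comp (seesawFst (adelic F E c N JV) (adelic F E c M₁ J₁) (adelic F E c M₂ J₂)) :=
  rfl

/-- `seesawSmall₂ s₂ = pairSmall₂ s₂ ∘ (id × pr₂)`. [folklore] -/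
theorem seesawSmall₂_eq (s₂ : adelicPair F E c N M₂ JV J₂ →* adelicMpCont F (Fin n₂) (adelicGram F e₂ TV T₂)) :
    seesawSmall₂ F E c N M₁ M₂ e₂ JV J₁ J₂ s₂ =
      (pairSmall₂ F E c N M₂ e₂ JV J₂ s₂).comp (seesawSnd (adelic F E c N JV) (adelic F E c M₁ J₁) (adelic F E c M₂ J₂)) :=
  rfl

/-- continuity of `pairSmall₁ s₁` along a continuous pair splitting. [cite: GelbartRogawski1991, §3.1 Prop. 3.1.1 p. 455] -/
theorem continuous_pairSmall₁ {s₁ : adelicPair F E c N M₁ JV J₁ →* adelicMpCont F (Fin n₁) (adelicGram F e₁ TV T₁)}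
    (hc₁ : Continuous (pairSplitting F E c N M₁ e₁ JV J₁ s₁)) : Continuous (pairSmall₁ F E c N M₁ e₁ JV J₁ s₁) :=
  (continuous_adelicMpContReindex_symm F e₁ _).comp hc₁

/-- continuity of `pairSmall₂ s₂` along a continuous pair splitting. [cite: GelbartRogawski1991, §3.1 Prop. 3.1.1 p. 455] -/
theorem continuous_pairSmall₂ {s₂ : adelicPair F E c N M₂ JV J₂ →* adelicMpCont F (Fin n₂) (adelicGram F e₂ TV T₂)}
    (hc₂ : Continuous (pairSplitting F E c N M₂ e₂ JV J₂ s₂)) : Continuous (pairSmall₂ F E c N M₂ e₂ JV J₂ s₂) :=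
  (continuous_adelicMpContReindex_symm F e₂ _).comp hc₂

/-- **the big pair splitting in BLOCK-SUM coordinates** `(Fin N × Fin M₁) ⊕ (Fin N × Fin M₂)` (Gram
`(T_V ⊗ T₁ ⊗ 1) ⊕ (T_V ⊗ T₂ ⊗ 1)`): `sumSeesawSplitting` along `finProdSumEquiv` of `seesawBig s`. [folklore] -/
def seesawBigSum (s : adelicPair F E c N (M₁ + M₂) JV (finSum M₁ M₂ J₁ J₂) →*
      adelicMpCont F (Fin n) (adelicGram F eW TV (finSum M₁ M₂ T₁ T₂))) :
    adelic F E c N JV × (adelic F E c M₁ J₁ × adelic F E c M₂ J₂) →*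
      adelicMpCont F ((Fin N × Fin M₁) ⊕ (Fin N × Fin M₂))
        (Matrix.fromBlocks (TV.map (algebraMap F (AdeleRing (𝓞 F) F)) ⊗ₖ T₁.map (algebraMap F (AdeleRing (𝓞 F) F))) 0 0
          (TV.map (algebraMap F (AdeleRing (𝓞 F) F)) ⊗ₖ T₂.map (algebraMap F (AdeleRing (𝓞 F) F)))) :=
  sumSeesawSplitting (finProdSumEquiv N M₁ M₂) (reindex_gram_finSum F N M₁ M₂) (seesawBig F E c N M₁ M₂ eW JV J₁ J₂ s)

/-- Unfolding. [folklore] -/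
theorem seesawBigSum_def (s : adelicPair F E c N (M₁ + M₂) JV (finSum M₁ M₂ J₁ J₂) →*
      adelicMpCont F (Fin n) (adelicGram F eW TV (finSum M₁ M₂ T₁ T₂))) :
    seesawBigSum F E c N M₁ M₂ eW JV J₁ J₂ s =
      sumSeesawSplitting (finProdSumEquiv N M₁ M₂) (reindex_gram_finSum F N M₁ M₂)
        (seesawBig F E c N M₁ M₂ eW JV J₁ J₂ s) :=
  rfl

/-- continuity of `seesawBigSum s`. [cite: GelbartRogawski1991, §3.1 Prop. 3.1.1 p. 455] -/
theorem continuous_seesawBigSum {s : adelicPair F E c N (M₁ + M₂) JV (finSum M₁ M₂ J₁ J₂) →*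
      adelicMpCont F (Fin n) (adelicGram F eW TV (finSum M₁ M₂ T₁ T₂))}
    (hc : Continuous (pairSplitting F E c N (M₁ + M₂) eW JV (finSum M₁ M₂ J₁ J₂) s)) :
    Continuous (seesawBigSum F E c N M₁ M₂ eW JV J₁ J₂ s) :=
  continuous_sumSeesawSplitting (finProdSumEquiv N M₁ M₂) (reindex_gram_finSum F N M₁ M₂) _
    (continuous_seesawBig' F E c N M₁ M₂ eW JV J₁ J₂ hc)

end Homs

/-! ## §2–§3 The `(12)` torus: factor characters and `RestrictTmul` on the nose -/

section Twelve

variable (F E : Type) [Field F] [NumberField F] [Field E] [NumberField E] [Algebra F E]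
variable (c : E ≃ₐ[F] E) (N M₁ M₂ : ℕ) {n n₁ n₂ : ℕ}
  (eW : Fin N × Fin (M₁ + M₂) ≃ Fin n) (e₁ : Fin N × Fin M₁ ≃ Fin n₁) (e₂ : Fin N × Fin M₂ ≃ Fin n₂)
variable (JV : Matrix (Fin N) (Fin N) E) (J₁ : Matrix (Fin M₁) (Fin M₁) E) (J₂ : Matrix (Fin M₂) (Fin M₂) E)
variable {TV : Matrix (Fin N) (Fin N) F} {T₁ : Matrix (Fin M₁) (Fin M₁) F} {T₂ : Matrix (Fin M₂) (Fin M₂) F}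
variable [Algebra.IsQuadraticExtension F E] {δ : E} (hcδ : c δ = -δ) (hδ : δ ≠ 0) {d : F}
  (hd : δ * δ = algebraMap F E d) (hV : TV.IsSymm) (h₁ : T₁.IsSymm) (h₂ : T₂.IsSymm) (hVd : IsUnit TV.det)
  (h₁d : IsUnit T₁.det) (h₂d : IsUnit T₂.det) (hWd : IsUnit (finSum M₁ M₂ T₁ T₂).det)
  (hJV : JV = TV.map (algebraMap F E)) (hJ₁ : J₁ = T₁.map (algebraMap F E)) (hJ₂ : J₂ = T₂.map (algebraMap F E))
  {s : adelicPair F E c N (M₁ + M₂) JV (finSum M₁ M₂ J₁ J₂) →*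
    adelicMpCont F (Fin n) (adelicGram F eW TV (finSum M₁ M₂ T₁ T₂))}
  {s₁ : adelicPair F E c N M₁ JV J₁ →* adelicMpCont F (Fin n₁) (adelicGram F e₁ TV T₁)}
  {s₂ : adelicPair F E c N M₂ JV J₂ →* adelicMpCont F (Fin n₂) (adelicGram F e₂ TV T₂)}
  (hs : (splittingDatum F E c N (M₁ + M₂) eW JV (finSum M₁ M₂ J₁ J₂) hcδ hδ hd hV (isSymm_finSum h₁ h₂) hVd hWd hJV
    (finSum_eq_map_finSum F E M₁ M₂ J₁ J₂ hJ₁ hJ₂)).IsCompatible s)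
  (hs₁ : (splittingDatum F E c N M₁ e₁ JV J₁ hcδ hδ hd hV h₁ hVd h₁d hJV hJ₁).IsCompatible s₁)
  (hs₂ : (splittingDatum F E c N M₂ e₂ JV J₂ hcδ hδ hd hV h₂ hVd h₂d hJV hJ₂).IsCompatible s₂)

include hs hs₁ hs₂ in
/-- **the see-saw hypothesis in the product shape of `AdelicMetaplecticSeesawCharacter`**:
`π(seesawBigSum s (g,(u₁,u₂))) = π(pairSmall₁ s₁ (g,u₁)) ⊕ π(pairSmall₂ s₂ (g,u₂))`. [cite: Kudla1984, §1] -/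
theorem hs₃_seesaw (g : adelic F E c N JV) (u₁ : adelic F E c M₁ J₁) (u₂ : adelic F E c M₂ J₂) :
    adelicMpCont.proj F ((Fin N × Fin M₁) ⊕ (Fin N × Fin M₂))
        (Matrix.fromBlocks (TV.map (algebraMap F (AdeleRing (𝓞 F) F)) ⊗ₖ T₁.map (algebraMap F (AdeleRing (𝓞 F) F))) 0 0
          (TV.map (algebraMap F (AdeleRing (𝓞 F) F)) ⊗ₖ T₂.map (algebraMap F (AdeleRing (𝓞 F) F))))
        (seesawBigSum F E c N M₁ M₂ eW JV J₁ J₂ s (g, (u₁, u₂))) =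
      spSum (TV.map (algebraMap F (AdeleRing (𝓞 F) F)) ⊗ₖ T₁.map (algebraMap F (AdeleRing (𝓞 F) F)))
        (TV.map (algebraMap F (AdeleRing (𝓞 F) F)) ⊗ₖ T₂.map (algebraMap F (AdeleRing (𝓞 F) F)))
        (adelicMpCont.proj F (Fin N × Fin M₁)
            (TV.map (algebraMap F (AdeleRing (𝓞 F) F)) ⊗ₖ T₁.map (algebraMap F (AdeleRing (𝓞 F) F)))
            (pairSmall₁ F E c N M₁ e₁ JV J₁ s₁ (g, u₁)),
          adelicMpCont.proj F (Fin N × Fin M₂)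
            (TV.map (algebraMap F (AdeleRing (𝓞 F) F)) ⊗ₖ T₂.map (algebraMap F (AdeleRing (𝓞 F) F)))
            (pairSmall₂ F E c N M₂ e₂ JV J₂ s₂ (g, u₂))) :=
  proj_sumSeesawSplitting (finProdSumEquiv N M₁ M₂) (reindex_gram_finSum F N M₁ M₂)
    (seesawBig F E c N M₁ M₂ eW JV J₁ J₂ s) (seesawSmall₁ F E c N M₁ M₂ e₁ JV J₁ J₂ s₁)
    (seesawSmall₂ F E c N M₁ M₂ e₂ JV J₁ J₂ s₂)
    (hS_seesaw F E c N M₁ M₂ eW e₁ e₂ JV J₁ J₂ hcδ hδ hd hV h₁ h₂ hVd h₁d h₂d hWd hJV hJ₁ hJ₂ hs hs₁ hs₂) (g, (u₁, u₂))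

/-- **`λ_V : U(J_V)(𝔸) →* ℂˣ`, `g ↦ χ₁₂(g,(1,1))`** — the `U(J_V)`-factor of the `(12)` see-saw character
(`AdelicMetaplecticSeesawCharacter.mpCharV` at the data of record). [folklore] -/
def charV₁₂ : adelic F E c N JV →* ℂˣ :=
  mpCharV (seesawBigSum F E c N M₁ M₂ eW JV J₁ J₂ s) (pairSmall₁ F E c N M₁ e₁ JV J₁ s₁) (pairSmall₂ F E c N M₂ e₂ JV J₂ s₂)
    (hs₃_seesaw F E c N M₁ M₂ eW e₁ e₂ JV J₁ J₂ hcδ hδ hd hV h₁ h₂ hVd h₁d h₂d hWd hJV hJ₁ hJ₂ hs hs₁ hs₂)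
    (isUnit_kronecker_map F N hVd h₁d) (isUnit_kronecker_map F N hVd h₂d)

/-- **`λ₁ : U(J₁)(𝔸) →* ℂˣ`, `u₁ ↦ χ₁₂(1,(u₁,1))`.** [folklore] -/
def char₁ : adelic F E c M₁ J₁ →* ℂˣ :=
  mpChar₁ (seesawBigSum F E c N M₁ M₂ eW JV J₁ J₂ s) (pairSmall₁ F E c N M₁ e₁ JV J₁ s₁) (pairSmall₂ F E c N M₂ e₂ JV J₂ s₂)
    (hs₃_seesaw F E c N M₁ M₂ eW e₁ e₂ JV J₁ J₂ hcδ hδ hd hV h₁ h₂ hVd h₁d h₂d hWd hJV hJ₁ hJ₂ hs hs₁ hs₂)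
    (isUnit_kronecker_map F N hVd h₁d) (isUnit_kronecker_map F N hVd h₂d)

/-- **`λ₂ : U(J₂)(𝔸) →* ℂˣ`, `u₂ ↦ χ₁₂(1,(1,u₂))`.** [folklore] -/
def char₂ : adelic F E c M₂ J₂ →* ℂˣ :=
  mpChar₂ (seesawBigSum F E c N M₁ M₂ eW JV J₁ J₂ s) (pairSmall₁ F E c N M₁ e₁ JV J₁ s₁) (pairSmall₂ F E c N M₂ e₂ JV J₂ s₂)
    (hs₃_seesaw F E c N M₁ M₂ eW e₁ e₂ JV J₁ J₂ hcδ hδ hd hV h₁ h₂ hVd h₁d h₂d hWd hJV hJ₁ hJ₂ hs hs₁ hs₂)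
    (isUnit_kronecker_map F N hVd h₁d) (isUnit_kronecker_map F N hVd h₂d)

/-- **`RestrictTmul` ON THE NOSE for the renormalised small pairs, `(12)` torus** (scheme small: the big representation
untouched, `ω ∘ pairSmall₁ s₁` twisted by `(g,u₁) ↦ λ_V g · λ₁ u₁`, `ω ∘ pairSmall₂ s₂` by `(g,u₂) ↦ λ₂ u₂`): for all
`g, u₁, u₂, Φ₁, Φ₂`, `ω(seesawBigSum s (g,(u₁,u₂))) (Φ₁ ⊠ Φ₂) = ω₁′(g,u₁) Φ₁ ⊠ ω₂′(g,u₂) Φ₂`.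
(cf. R. Howe (1979) §3; S. Kudla (1984) §1) [folklore] -/
theorem restrictTmul₁₂ (g : adelic F E c N JV) (u₁ : adelic F E c M₁ J₁) (u₂ : adelic F E c M₂ J₂)
    (Φ₁ : piSchwartzBruhat F (Fin N × Fin M₁)) (Φ₂ : piSchwartzBruhat F (Fin N × Fin M₂)) :
    adelicMpCont.omega F ((Fin N × Fin M₁) ⊕ (Fin N × Fin M₂))
        (Matrix.fromBlocks (TV.map (algebraMap F (AdeleRing (𝓞 F) F)) ⊗ₖ T₁.map (algebraMap F (AdeleRing (𝓞 F) F))) 0 0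
          (TV.map (algebraMap F (AdeleRing (𝓞 F) F)) ⊗ₖ T₂.map (algebraMap F (AdeleRing (𝓞 F) F))))
        (seesawBigSum F E c N M₁ M₂ eW JV J₁ J₂ s (g, (u₁, u₂)))
        (tensorToSum F (Fin N × Fin M₁) (Fin N × Fin M₂) Φ₁ Φ₂) =
      tensorToSum F (Fin N × Fin M₁) (Fin N × Fin M₂)
        (twist (mpCharSmall₁ (seesawBigSum F E c N M₁ M₂ eW JV J₁ J₂ s) (pairSmall₁ F E c N M₁ e₁ JV J₁ s₁)
            (pairSmall₂ F E c N M₂ e₂ JV J₂ s₂)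
            (hs₃_seesaw F E c N M₁ M₂ eW e₁ e₂ JV J₁ J₂ hcδ hδ hd hV h₁ h₂ hVd h₁d h₂d hWd hJV hJ₁ hJ₂ hs hs₁ hs₂)
            (isUnit_kronecker_map F N hVd h₁d) (isUnit_kronecker_map F N hVd h₂d))
          ((adelicMpCont.omega F (Fin N × Fin M₁)
            (TV.map (algebraMap F (AdeleRing (𝓞 F) F)) ⊗ₖ T₁.map (algebraMap F (AdeleRing (𝓞 F) F)))).comp
            (pairSmall₁ F E c N M₁ e₁ JV J₁ s₁)) (g, u₁) Φ₁)
        (twist (mpCharSmall₂ (seesawBigSum F E c N M₁ M₂ eW JV J₁ J₂ s) (pairSmall₁ F E c N M₁ e₁ JV J₁ s₁)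
            (pairSmall₂ F E c N M₂ e₂ JV J₂ s₂)
            (hs₃_seesaw F E c N M₁ M₂ eW e₁ e₂ JV J₁ J₂ hcδ hδ hd hV h₁ h₂ hVd h₁d h₂d hWd hJV hJ₁ hJ₂ hs hs₁ hs₂)
            (isUnit_kronecker_map F N hVd h₁d) (isUnit_kronecker_map F N hVd h₂d))
          ((adelicMpCont.omega F (Fin N × Fin M₂)
            (TV.map (algebraMap F (AdeleRing (𝓞 F) F)) ⊗ₖ T₂.map (algebraMap F (AdeleRing (𝓞 F) F)))).comp
            (pairSmall₂ F E c N M₂ e₂ JV J₂ s₂)) (g, u₂) Φ₂) :=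
  mpSeesaw_tensorToSum_twist_small _ _ _
    (hs₃_seesaw F E c N M₁ M₂ eW e₁ e₂ JV J₁ J₂ hcδ hδ hd hV h₁ h₂ hVd h₁d h₂d hWd hJV hJ₁ hJ₂ hs hs₁ hs₂) _ _ g u₁ u₂ Φ₁ Φ₂

include hcδ hδ hd hV h₁ h₂ hVd hWd hJV hJ₁ hJ₂ hs in
/-- `Θ`-fixing at rational points of the big splitting in block-sum coordinates (range form).
[cite: Weil1964, Chap. III n° 41 Thm 6 p. 193] -/
theorem coe_seesawBigSum_mem_adelicMpTheta {g : adelic F E c N JV} (hg : g ∈ (toAdelic F E c N JV).range)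
    {u₁ : adelic F E c M₁ J₁} (hu₁ : u₁ ∈ (toAdelic F E c M₁ J₁).range)
    {u₂ : adelic F E c M₂ J₂} (hu₂ : u₂ ∈ (toAdelic F E c M₂ J₂).range) :
    ((seesawBigSum F E c N M₁ M₂ eW JV J₁ J₂ s (g, (u₁, u₂)) : adelicMpCont F _ _) : adelicMp F _ _) ∈
      adelicMpTheta F ((Fin N × Fin M₁) ⊕ (Fin N × Fin M₂))
        (Matrix.fromBlocks (TV.map (algebraMap F (AdeleRing (𝓞 F) F)) ⊗ₖ T₁.map (algebraMap F (AdeleRing (𝓞 F) F))) 0 0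
          (TV.map (algebraMap F (AdeleRing (𝓞 F) F)) ⊗ₖ T₂.map (algebraMap F (AdeleRing (𝓞 F) F)))) := by
  obtain ⟨γV, rfl⟩ := hg
  obtain ⟨γ₁, rfl⟩ := hu₁
  obtain ⟨γ₂, rfl⟩ := hu₂
  exact (sumSeesawSplitting_mem_adelicMpTheta_iff (finProdSumEquiv N M₁ M₂) (reindex_gram_finSum F N M₁ M₂) _ _).2
    (coe_seesawBig_mem_adelicMpTheta F E c N M₁ M₂ eW JV J₁ J₂ hcδ hδ hd hV h₁ h₂ hVd hWd hJV hJ₁ hJ₂ hs γV γ₁ γ₂)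

include hcδ hδ hd hV h₁ hVd h₁d hJV hJ₁ hs₁ in
/-- `Θ`-fixing at rational points of `pairSmall₁ s₁` (range form). [cite: Weil1964, Chap. III n° 41 Thm 6 p. 193] -/
theorem coe_pairSmall₁_mem_adelicMpTheta {g : adelic F E c N JV} (hg : g ∈ (toAdelic F E c N JV).range)
    {u₁ : adelic F E c M₁ J₁} (hu₁ : u₁ ∈ (toAdelic F E c M₁ J₁).range) :
    ((pairSmall₁ F E c N M₁ e₁ JV J₁ s₁ (g, u₁) : adelicMpCont F _ _) : adelicMp F _ _) ∈
      adelicMpTheta F (Fin N × Fin M₁)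
        (TV.map (algebraMap F (AdeleRing (𝓞 F) F)) ⊗ₖ T₁.map (algebraMap F (AdeleRing (𝓞 F) F))) :=
  (coe_adelicMpContReindex_symm_mem_adelicMpTheta_iff F e₁ _ _).2
    ((MpPsi.mem_fixing_iff _ _ _).2 fun Φ =>
      thetaDistLM_pairRep_rat F E c N M₁ e₁ JV J₁ hcδ hδ hd hV h₁ hVd h₁d hJV hJ₁ hs₁ hg hu₁ Φ)

include hcδ hδ hd hV h₂ hVd h₂d hJV hJ₂ hs₂ in
/-- `Θ`-fixing at rational points of `pairSmall₂ s₂` (range form). [cite: Weil1964, Chap. III n° 41 Thm 6 p. 193] -/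
theorem coe_pairSmall₂_mem_adelicMpTheta {g : adelic F E c N JV} (hg : g ∈ (toAdelic F E c N JV).range)
    {u₂ : adelic F E c M₂ J₂} (hu₂ : u₂ ∈ (toAdelic F E c M₂ J₂).range) :
    ((pairSmall₂ F E c N M₂ e₂ JV J₂ s₂ (g, u₂) : adelicMpCont F _ _) : adelicMp F _ _) ∈
      adelicMpTheta F (Fin N × Fin M₂)
        (TV.map (algebraMap F (AdeleRing (𝓞 F) F)) ⊗ₖ T₂.map (algebraMap F (AdeleRing (𝓞 F) F))) :=
  (coe_adelicMpContReindex_symm_mem_adelicMpTheta_iff F e₂ _ _).2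
    ((MpPsi.mem_fixing_iff _ _ _).2 fun Φ =>
      thetaDistLM_pairRep_rat F E c N M₂ e₂ JV J₂ hcδ hδ hd hV h₂ hVd h₂d hJV hJ₂ hs₂ hg hu₂ Φ)

/-- **`λ_V = 1` on `U(J_V)(F)`** (automorphic). [cite: Weil1964, Chap. III n° 41 Thm 6 p. 193] -/
theorem charV₁₂_eq_one_of_rational {g : adelic F E c N JV} (hg : g ∈ (toAdelic F E c N JV).range) :
    charV₁₂ F E c N M₁ M₂ eW e₁ e₂ JV J₁ J₂ hcδ hδ hd hV h₁ h₂ hVd h₁d h₂d hWd hJV hJ₁ hJ₂ hs hs₁ hs₂ g = 1 :=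
  mpCharV_eq_one_of_mem_adelicMpTheta _ _ _
    (hs₃_seesaw F E c N M₁ M₂ eW e₁ e₂ JV J₁ J₂ hcδ hδ hd hV h₁ h₂ hVd h₁d h₂d hWd hJV hJ₁ hJ₂ hs hs₁ hs₂) _ _
    (coe_seesawBigSum_mem_adelicMpTheta F E c N M₁ M₂ eW JV J₁ J₂ hcδ hδ hd hV h₁ h₂ hVd hWd hJV hJ₁ hJ₂ hs hg
      (one_mem _) (one_mem _))
    (coe_pairSmall₁_mem_adelicMpTheta F E c N M₁ e₁ JV J₁ hcδ hδ hd hV h₁ hVd h₁d hJV hJ₁ hs₁ hg (one_mem _))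
    (coe_pairSmall₂_mem_adelicMpTheta F E c N M₂ e₂ JV J₂ hcδ hδ hd hV h₂ hVd h₂d hJV hJ₂ hs₂ hg (one_mem _))

/-- **`λ₁ = 1` on `U(J₁)(F)`.** [cite: Weil1964, Chap. III n° 41 Thm 6 p. 193] -/
theorem char₁_eq_one_of_rational {u₁ : adelic F E c M₁ J₁} (hu₁ : u₁ ∈ (toAdelic F E c M₁ J₁).range) :
    char₁ F E c N M₁ M₂ eW e₁ e₂ JV J₁ J₂ hcδ hδ hd hV h₁ h₂ hVd h₁d h₂d hWd hJV hJ₁ hJ₂ hs hs₁ hs₂ u₁ = 1 :=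
  mpChar₁_eq_one_of_mem_adelicMpTheta _ _ _
    (hs₃_seesaw F E c N M₁ M₂ eW e₁ e₂ JV J₁ J₂ hcδ hδ hd hV h₁ h₂ hVd h₁d h₂d hWd hJV hJ₁ hJ₂ hs hs₁ hs₂) _ _
    (coe_seesawBigSum_mem_adelicMpTheta F E c N M₁ M₂ eW JV J₁ J₂ hcδ hδ hd hV h₁ h₂ hVd hWd hJV hJ₁ hJ₂ hs (one_mem _)
      hu₁ (one_mem _))
    (coe_pairSmall₁_mem_adelicMpTheta F E c N M₁ e₁ JV J₁ hcδ hδ hd hV h₁ hVd h₁d hJV hJ₁ hs₁ (one_mem _) hu₁)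

/-- **`λ₂ = 1` on `U(J₂)(F)`.** [cite: Weil1964, Chap. III n° 41 Thm 6 p. 193] -/
theorem char₂_eq_one_of_rational {u₂ : adelic F E c M₂ J₂} (hu₂ : u₂ ∈ (toAdelic F E c M₂ J₂).range) :
    char₂ F E c N M₁ M₂ eW e₁ e₂ JV J₁ J₂ hcδ hδ hd hV h₁ h₂ hVd h₁d h₂d hWd hJV hJ₁ hJ₂ hs hs₁ hs₂ u₂ = 1 :=
  mpChar₂_eq_one_of_mem_adelicMpTheta _ _ _
    (hs₃_seesaw F E c N M₁ M₂ eW e₁ e₂ JV J₁ J₂ hcδ hδ hd hV h₁ h₂ hVd h₁d h₂d hWd hJV hJ₁ hJ₂ hs hs₁ hs₂) _ _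
    (coe_seesawBigSum_mem_adelicMpTheta F E c N M₁ M₂ eW JV J₁ J₂ hcδ hδ hd hV h₁ h₂ hVd hWd hJV hJ₁ hJ₂ hs (one_mem _)
      (one_mem _) hu₂)
    (coe_pairSmall₂_mem_adelicMpTheta F E c N M₂ e₂ JV J₂ hcδ hδ hd hV h₂ hVd h₂d hJV hJ₂ hs₂ (one_mem _) hu₂)

/-- **`λ_V` is continuous** along continuous pair splittings. [cite: Weil1964, Chap. III n° 39 p. 189] -/
theorem continuous_charV₁₂ (hc : Continuous (pairSplitting F E c N (M₁ + M₂) eW JV (finSum M₁ M₂ J₁ J₂) s))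
    (hc₁ : Continuous (pairSplitting F E c N M₁ e₁ JV J₁ s₁)) (hc₂ : Continuous (pairSplitting F E c N M₂ e₂ JV J₂ s₂)) :
    Continuous fun g : adelic F E c N JV =>
      (charV₁₂ F E c N M₁ M₂ eW e₁ e₂ JV J₁ J₂ hcδ hδ hd hV h₁ h₂ hVd h₁d h₂d hWd hJV hJ₁ hJ₂ hs hs₁ hs₂ g : ℂ) :=
  continuous_mpCharV _ _ _
    (hs₃_seesaw F E c N M₁ M₂ eW e₁ e₂ JV J₁ J₂ hcδ hδ hd hV h₁ h₂ hVd h₁d h₂d hWd hJV hJ₁ hJ₂ hs hs₁ hs₂) _ _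
    (continuous_seesawBigSum F E c N M₁ M₂ eW JV J₁ J₂ hc) (continuous_pairSmall₁ F E c N M₁ e₁ JV J₁ hc₁)
    (continuous_pairSmall₂ F E c N M₂ e₂ JV J₂ hc₂)

/-- **`λ₁` is continuous.** [cite: Weil1964, Chap. III n° 39 p. 189] -/
theorem continuous_char₁ (hc : Continuous (pairSplitting F E c N (M₁ + M₂) eW JV (finSum M₁ M₂ J₁ J₂) s))
    (hc₁ : Continuous (pairSplitting F E c N M₁ e₁ JV J₁ s₁)) (hc₂ : Continuous (pairSplitting F E c N M₂ e₂ JV J₂ s₂)) :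
    Continuous fun u : adelic F E c M₁ J₁ =>
      (char₁ F E c N M₁ M₂ eW e₁ e₂ JV J₁ J₂ hcδ hδ hd hV h₁ h₂ hVd h₁d h₂d hWd hJV hJ₁ hJ₂ hs hs₁ hs₂ u : ℂ) :=
  continuous_mpChar₁ _ _ _
    (hs₃_seesaw F E c N M₁ M₂ eW e₁ e₂ JV J₁ J₂ hcδ hδ hd hV h₁ h₂ hVd h₁d h₂d hWd hJV hJ₁ hJ₂ hs hs₁ hs₂) _ _
    (continuous_seesawBigSum F E c N M₁ M₂ eW JV J₁ J₂ hc) (continuous_pairSmall₁ F E c N M₁ e₁ JV J₁ hc₁)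
    (continuous_pairSmall₂ F E c N M₂ e₂ JV J₂ hc₂)

/-- **`λ₂` is continuous.** [cite: Weil1964, Chap. III n° 39 p. 189] -/
theorem continuous_char₂ (hc : Continuous (pairSplitting F E c N (M₁ + M₂) eW JV (finSum M₁ M₂ J₁ J₂) s))
    (hc₁ : Continuous (pairSplitting F E c N M₁ e₁ JV J₁ s₁)) (hc₂ : Continuous (pairSplitting F E c N M₂ e₂ JV J₂ s₂)) :
    Continuous fun u : adelic F E c M₂ J₂ =>
      (char₂ F E c N M₁ M₂ eW e₁ e₂ JV J₁ J₂ hcδ hδ hd hV h₁ h₂ hVd h₁d h₂d hWd hJV hJ₁ hJ₂ hs hs₁ hs₂ u : ℂ) :=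
  continuous_mpChar₂ _ _ _
    (hs₃_seesaw F E c N M₁ M₂ eW e₁ e₂ JV J₁ J₂ hcδ hδ hd hV h₁ h₂ hVd h₁d h₂d hWd hJV hJ₁ hJ₂ hs hs₁ hs₂) _ _
    (continuous_seesawBigSum F E c N M₁ M₂ eW JV J₁ J₂ hc) (continuous_pairSmall₁ F E c N M₁ e₁ JV J₁ hc₁)
    (continuous_pairSmall₂ F E c N M₂ e₂ JV J₂ hc₂)

/-! ### Read-back of the block-sum Weil operators and theta functional, `(12)` -/

omit [Algebra.IsQuadraticExtension F E] in
/-- `ω(seesawBigSum s p) Ψ = R_f (ω(seesawBig s p) (R_f⁻¹ Ψ))`, `f = finProdSumEquiv N M₁ M₂`. [folklore] -/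
theorem omega_seesawBigSum_apply (p : adelic F E c N JV × (adelic F E c M₁ J₁ × adelic F E c M₂ J₂))
    (Ψ : piSchwartzBruhat F ((Fin N × Fin M₁) ⊕ (Fin N × Fin M₂))) :
    adelicMpCont.omega F ((Fin N × Fin M₁) ⊕ (Fin N × Fin M₂))
        (Matrix.fromBlocks (TV.map (algebraMap F (AdeleRing (𝓞 F) F)) ⊗ₖ T₁.map (algebraMap F (AdeleRing (𝓞 F) F))) 0 0
          (TV.map (algebraMap F (AdeleRing (𝓞 F) F)) ⊗ₖ T₂.map (algebraMap F (AdeleRing (𝓞 F) F))))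
        (seesawBigSum F E c N M₁ M₂ eW JV J₁ J₂ s p) Ψ =
      piSBReindex F (finProdSumEquiv N M₁ M₂)
        (adelicMpCont.omega F (Fin N × Fin (M₁ + M₂))
          (TV.map (algebraMap F (AdeleRing (𝓞 F) F)) ⊗ₖ (finSum M₁ M₂ T₁ T₂).map (algebraMap F (AdeleRing (𝓞 F) F)))
          (seesawBig F E c N M₁ M₂ eW JV J₁ J₂ s p) ((piSBReindex F (finProdSumEquiv N M₁ M₂)).symm Ψ)) :=
  omega_sumSeesawSplitting_apply (finProdSumEquiv N M₁ M₂) (reindex_gram_finSum F N M₁ M₂) _ p Ψ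

omit [Algebra.IsQuadraticExtension F E] in
/-- **the block-sum theta functional is the big pair's**: `Θ(ω(seesawBigSum s (g,(u₁,u₂))) Ψ) =
Θ(ω(s_pair(g, u₁ ⊕ᶠ u₂)) (R_{e_W} (R_f⁻¹ Ψ)))` — so the theta KERNEL of `Ψ` for the block-sum model at `(g,(u₁,u₂))` is
the theta kernel of `R_{e_W} R_f⁻¹ Ψ` for the splitting of record at `(g, u₁ ⊕ᶠ u₂)` (the `ϑ_period` junction).
[cite: Weil1964, Chap. III n° 41 Thm 6 p. 193] -/
theorem thetaDistLM_omega_seesawBigSum (p : adelic F E c N JV × (adelic F E c M₁ J₁ × adelic F E c M₂ J₂))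
    (Ψ : piSchwartzBruhat F ((Fin N × Fin M₁) ⊕ (Fin N × Fin M₂))) :
    thetaDistLM F ((Fin N × Fin M₁) ⊕ (Fin N × Fin M₂))
        (adelicMpCont.omega F ((Fin N × Fin M₁) ⊕ (Fin N × Fin M₂))
          (Matrix.fromBlocks (TV.map (algebraMap F (AdeleRing (𝓞 F) F)) ⊗ₖ T₁.map (algebraMap F (AdeleRing (𝓞 F) F))) 0 0
            (TV.map (algebraMap F (AdeleRing (𝓞 F) F)) ⊗ₖ T₂.map (algebraMap F (AdeleRing (𝓞 F) F))))
          (seesawBigSum F E c N M₁ M₂ eW JV J₁ J₂ s p) Ψ) =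
      thetaDistLM F (Fin n)
        (adelicMpCont.omega F (Fin n) (adelicGram F eW TV (finSum M₁ M₂ T₁ T₂))
          (pairSplitting F E c N (M₁ + M₂) eW JV (finSum M₁ M₂ J₁ J₂) s (p.1, adelicBlockDiag F E c M₁ M₂ J₁ J₂ p.2))
          (piSBReindex F eW ((piSBReindex F (finProdSumEquiv N M₁ M₂)).symm Ψ))) :=
  (congrArg (thetaDistLM F ((Fin N × Fin M₁) ⊕ (Fin N × Fin M₂)))
      (omega_seesawBigSum_apply F E c N M₁ M₂ eW JV J₁ J₂ (s := s) p Ψ)).trans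
    ((thetaDistLM_piSBReindex F (finProdSumEquiv N M₁ M₂) _).trans
      ((congrArg (thetaDistLM F (Fin N × Fin (M₁ + M₂)))
          (omega_seesawBig_apply F E c N M₁ M₂ eW JV J₁ J₂ s p _)).trans
        (thetaDistLM_piSBReindex F eW.symm _)))

end Twelve

/-! ## §4 The conjugated `(34)` torus: factor character and `RestrictTmul` on the nose -/

section ThirtyFour

variable (F E : Type) [Field F] [NumberField F] [Field E] [NumberField E] [Algebra F E]
variable (c : E ≃ₐ[F] E) (N M₁ M₂ : ℕ) {n n₁ n₂ : ℕ} (eW : Fin N × Fin (M₁ + M₂) ≃ Fin n)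
  (e₁ : Fin N × Fin M₁ ≃ Fin n₁) (e₂ : Fin N × Fin M₂ ≃ Fin n₂)
variable (JV : Matrix (Fin N) (Fin N) E) (JW : Matrix (Fin (M₁ + M₂)) (Fin (M₁ + M₂)) E)
  (J₁ : Matrix (Fin M₁) (Fin M₁) E) (J₂ : Matrix (Fin M₂) (Fin M₂) E)
variable {TV : Matrix (Fin N) (Fin N) F} {TW : Matrix (Fin (M₁ + M₂)) (Fin (M₁ + M₂)) F}
  {T₁ : Matrix (Fin M₁) (Fin M₁) F} {T₂ : Matrix (Fin M₂) (Fin M₂) F}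
variable [Algebra.IsQuadraticExtension F E] {δ : E} (hcδ : c δ = -δ) (hδ : δ ≠ 0) {d : F}
  (hd : δ * δ = algebraMap F E d) (hV : TV.IsSymm) (hW : TW.IsSymm) (h₁ : T₁.IsSymm) (h₂ : T₂.IsSymm)
  (hVd : IsUnit TV.det) (hTWd : IsUnit TW.det) (h₁d : IsUnit T₁.det) (h₂d : IsUnit T₂.det)
  (hT : IsUnit (TV.map (algebraMap F (AdeleRing (𝓞 F) F)) ⊗ₖ TW.map (algebraMap F (AdeleRing (𝓞 F) F))).det)
  (hJV : JV = TV.map (algebraMap F E)) (hJW : JW = TW.map (algebraMap F E))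
  (hJ₁ : J₁ = T₁.map (algebraMap F E)) (hJ₂ : J₂ = T₂.map (algebraMap F E))
  {s : adelicPair F E c N (M₁ + M₂) JV JW →* adelicMpCont F (Fin n) (adelicGram F eW TV TW)}
  {s₁ : adelicPair F E c N M₁ JV J₁ →* adelicMpCont F (Fin n₁) (adelicGram F e₁ TV T₁)}
  {s₂ : adelicPair F E c N M₂ JV J₂ →* adelicMpCont F (Fin n₂) (adelicGram F e₂ TV T₂)}
  {g : GL (Fin (M₁ + M₂)) (AdeleRing (𝓞 E) E)} {g₀ : GL (Fin (M₁ + M₂)) E}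
  (hgg₀ : (g : Matrix (Fin (M₁ + M₂)) (Fin (M₁ + M₂)) (AdeleRing (𝓞 E) E)) =
    ((g₀ : GL (Fin (M₁ + M₂)) E) : Matrix (Fin (M₁ + M₂)) (Fin (M₁ + M₂)) E).map (algebraMap E (AdeleRing (𝓞 E) E)))
  (hg : ((g : Matrix (Fin (M₁ + M₂)) (Fin (M₁ + M₂)) (AdeleRing (𝓞 E) E)).map (conjAdele F E c))ᵀ *
      adelicForm E (M₁ + M₂) JW * g = adelicForm E (M₁ + M₂) (finSum M₁ M₂ J₁ J₂))
  {C : GL (Fin N × Fin (M₁ + M₂)) (AdeleRing (𝓞 F) F)} {C₀ : GL (Fin N × Fin (M₁ + M₂)) F}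
  (hCC₀ : (C : Matrix (Fin N × Fin (M₁ + M₂)) (Fin N × Fin (M₁ + M₂)) (AdeleRing (𝓞 F) F)) =
    ((C₀ : GL (Fin N × Fin (M₁ + M₂)) F) : Matrix (Fin N × Fin (M₁ + M₂)) (Fin N × Fin (M₁ + M₂)) F).map
      (algebraMap F (AdeleRing (𝓞 F) F)))
  (hC : TV.map (algebraMap F (AdeleRing (𝓞 F) F)) ⊗ₖ TW.map (algebraMap F (AdeleRing (𝓞 F) F)) *
      (C : Matrix (Fin N × Fin (M₁ + M₂)) (Fin N × Fin (M₁ + M₂)) (AdeleRing (𝓞 F) F)) =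
    TV.map (algebraMap F (AdeleRing (𝓞 F) F)) ⊗ₖ (finSum M₁ M₂ T₁ T₂).map (algebraMap F (AdeleRing (𝓞 F) F)))

/-- **the conjugated big splitting in BLOCK-SUM coordinates**: `sumSeesawSplitting` along `finProdSumEquiv` of
`seesawConjSplitting`. [folklore] -/
def seesawConjSum :
    adelic F E c N JV × (adelic F E c M₁ J₁ × adelic F E c M₂ J₂) →*
      adelicMpCont F ((Fin N × Fin M₁) ⊕ (Fin N × Fin M₂))
        (Matrix.fromBlocks (TV.map (algebraMap F (AdeleRing (𝓞 F) F)) ⊗ₖ T₁.map (algebraMap F (AdeleRing (𝓞 F) F))) 0 0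
          (TV.map (algebraMap F (AdeleRing (𝓞 F) F)) ⊗ₖ T₂.map (algebraMap F (AdeleRing (𝓞 F) F)))) :=
  sumSeesawSplitting (finProdSumEquiv N M₁ M₂) (reindex_gram_finSum F N M₁ M₂)
    (seesawConjSplitting F E c N M₁ M₂ eW JV JW J₁ J₂ hcδ hδ hd hV hW h₁ h₂ hVd hTWd hT hJV hJW hJ₁ hJ₂ hgg₀ hg hCC₀ hC
      (s := s))

/-- Unfolding. [folklore] -/
theorem seesawConjSum_def :
    seesawConjSum F E c N M₁ M₂ eW JV JW J₁ J₂ hcδ hδ hd hV hW h₁ h₂ hVd hTWd hT hJV hJW hJ₁ hJ₂ hgg₀ hg hCC₀ hC (s := s) =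
      sumSeesawSplitting (finProdSumEquiv N M₁ M₂) (reindex_gram_finSum F N M₁ M₂)
        (seesawConjSplitting F E c N M₁ M₂ eW JV JW J₁ J₂ hcδ hδ hd hV hW h₁ h₂ hVd hTWd hT hJV hJW hJ₁ hJ₂ hgg₀ hg hCC₀
          hC (s := s)) :=
  rfl

variable
  (hs : (splittingDatum F E c N (M₁ + M₂) eW JV JW hcδ hδ hd hV hW hVd hTWd hJV hJW).IsCompatible s)
  (hs₁ : (splittingDatum F E c N M₁ e₁ JV J₁ hcδ hδ hd hV h₁ hVd h₁d hJV hJ₁).IsCompatible s₁)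
  (hs₂ : (splittingDatum F E c N M₂ e₂ JV J₂ hcδ hδ hd hV h₂ hVd h₂d hJV hJ₂).IsCompatible s₂)

include hs hs₁ hs₂ in
/-- **the see-saw hypothesis in the product shape, conjugated torus**:
`π(seesawConjSum (g,(u₁,u₂))) = π(pairSmall₁ s₁ (g,u₁)) ⊕ π(pairSmall₂ s₂ (g,u₂))`. [cite: Kudla1984, §1] -/
theorem hs₃_seesawConj (v : adelic F E c N JV) (u₁ : adelic F E c M₁ J₁) (u₂ : adelic F E c M₂ J₂) :
    adelicMpCont.proj F ((Fin N × Fin M₁) ⊕ (Fin N × Fin M₂))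
        (Matrix.fromBlocks (TV.map (algebraMap F (AdeleRing (𝓞 F) F)) ⊗ₖ T₁.map (algebraMap F (AdeleRing (𝓞 F) F))) 0 0
          (TV.map (algebraMap F (AdeleRing (𝓞 F) F)) ⊗ₖ T₂.map (algebraMap F (AdeleRing (𝓞 F) F))))
        (seesawConjSum F E c N M₁ M₂ eW JV JW J₁ J₂ hcδ hδ hd hV hW h₁ h₂ hVd hTWd hT hJV hJW hJ₁ hJ₂ hgg₀ hg hCC₀ hC
          (s := s) (v, (u₁, u₂))) =
      spSum (TV.map (algebraMap F (AdeleRing (𝓞 F) F)) ⊗ₖ T₁.map (algebraMap F (AdeleRing (𝓞 F) F)))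
        (TV.map (algebraMap F (AdeleRing (𝓞 F) F)) ⊗ₖ T₂.map (algebraMap F (AdeleRing (𝓞 F) F)))
        (adelicMpCont.proj F (Fin N × Fin M₁)
            (TV.map (algebraMap F (AdeleRing (𝓞 F) F)) ⊗ₖ T₁.map (algebraMap F (AdeleRing (𝓞 F) F)))
            (pairSmall₁ F E c N M₁ e₁ JV J₁ s₁ (v, u₁)),
          adelicMpCont.proj F (Fin N × Fin M₂)
            (TV.map (algebraMap F (AdeleRing (𝓞 F) F)) ⊗ₖ T₂.map (algebraMap F (AdeleRing (𝓞 F) F)))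
            (pairSmall₂ F E c N M₂ e₂ JV J₂ s₂ (v, u₂))) :=
  proj_sumSeesawSplitting (finProdSumEquiv N M₁ M₂) (reindex_gram_finSum F N M₁ M₂) _
    (seesawSmall₁ F E c N M₁ M₂ e₁ JV J₁ J₂ s₁) (seesawSmall₂ F E c N M₁ M₂ e₂ JV J₁ J₂ s₂)
    (hS_seesawConj F E c N M₁ M₂ eW e₁ e₂ JV JW J₁ J₂ hcδ hδ hd hV hW h₁ h₂ hVd hTWd h₁d h₂d hT hJV hJW hJ₁ hJ₂ hgg₀ hg
      hCC₀ hC hs hs₁ hs₂) (v, (u₁, u₂))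

/-- **`λ_V′ : U(J_V)(𝔸) →* ℂˣ`, `v ↦ χ₃₄(v,(1,1))`** — the `U(J_V)`-factor of the see-saw character of the CONJUGATED
torus. [folklore] -/
def charV₃₄ : adelic F E c N JV →* ℂˣ :=
  mpCharV (seesawConjSum F E c N M₁ M₂ eW JV JW J₁ J₂ hcδ hδ hd hV hW h₁ h₂ hVd hTWd hT hJV hJW hJ₁ hJ₂ hgg₀ hg hCC₀ hC
      (s := s))
    (pairSmall₁ F E c N M₁ e₁ JV J₁ s₁) (pairSmall₂ F E c N M₂ e₂ JV J₂ s₂)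
    (hs₃_seesawConj F E c N M₁ M₂ eW e₁ e₂ JV JW J₁ J₂ hcδ hδ hd hV hW h₁ h₂ hVd hTWd h₁d h₂d hT hJV hJW hJ₁ hJ₂ hgg₀ hg
      hCC₀ hC hs hs₁ hs₂)
    (isUnit_kronecker_map F N hVd h₁d) (isUnit_kronecker_map F N hVd h₂d)

/-- **`RestrictTmul` ON THE NOSE for the renormalised small pairs, CONJUGATED `(34)` torus** (scheme small; the big
representation, read in the transported block-sum model, untouched): for all `v, u₁, u₂, Φ₁, Φ₂`,
`ω(seesawConjSum (v,(u₁,u₂))) (Φ₁ ⊠ Φ₂) = ω₁″(v,u₁) Φ₁ ⊠ ω₂″(v,u₂) Φ₂`. (cf. R. Howe (1979) §3; S. Kudla (1984) §1) [folklore] -/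
theorem restrictTmul₃₄ (v : adelic F E c N JV) (u₁ : adelic F E c M₁ J₁) (u₂ : adelic F E c M₂ J₂)
    (Φ₁ : piSchwartzBruhat F (Fin N × Fin M₁)) (Φ₂ : piSchwartzBruhat F (Fin N × Fin M₂)) :
    adelicMpCont.omega F ((Fin N × Fin M₁) ⊕ (Fin N × Fin M₂))
        (Matrix.fromBlocks (TV.map (algebraMap F (AdeleRing (𝓞 F) F)) ⊗ₖ T₁.map (algebraMap F (AdeleRing (𝓞 F) F))) 0 0
          (TV.map (algebraMap F (AdeleRing (𝓞 F) F)) ⊗ₖ T₂.map (algebraMap F (AdeleRing (𝓞 F) F))))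
        (seesawConjSum F E c N M₁ M₂ eW JV JW J₁ J₂ hcδ hδ hd hV hW h₁ h₂ hVd hTWd hT hJV hJW hJ₁ hJ₂ hgg₀ hg hCC₀ hC
          (s := s) (v, (u₁, u₂)))
        (tensorToSum F (Fin N × Fin M₁) (Fin N × Fin M₂) Φ₁ Φ₂) =
      tensorToSum F (Fin N × Fin M₁) (Fin N × Fin M₂)
        (twist (mpCharSmall₁
            (seesawConjSum F E c N M₁ M₂ eW JV JW J₁ J₂ hcδ hδ hd hV hW h₁ h₂ hVd hTWd hT hJV hJW hJ₁ hJ₂ hgg₀ hg hCC₀ hC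
              (s := s))
            (pairSmall₁ F E c N M₁ e₁ JV J₁ s₁) (pairSmall₂ F E c N M₂ e₂ JV J₂ s₂)
            (hs₃_seesawConj F E c N M₁ M₂ eW e₁ e₂ JV JW J₁ J₂ hcδ hδ hd hV hW h₁ h₂ hVd hTWd h₁d h₂d hT hJV hJW hJ₁ hJ₂
              hgg₀ hg hCC₀ hC hs hs₁ hs₂)
            (isUnit_kronecker_map F N hVd h₁d) (isUnit_kronecker_map F N hVd h₂d))
          ((adelicMpCont.omega F (Fin N × Fin M₁)
            (TV.map (algebraMap F (AdeleRing (𝓞 F) F)) ⊗ₖ T₁.map (algebraMap F (AdeleRing (𝓞 F) F)))).comp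
            (pairSmall₁ F E c N M₁ e₁ JV J₁ s₁)) (v, u₁) Φ₁)
        (twist (mpCharSmall₂
            (seesawConjSum F E c N M₁ M₂ eW JV JW J₁ J₂ hcδ hδ hd hV hW h₁ h₂ hVd hTWd hT hJV hJW hJ₁ hJ₂ hgg₀ hg hCC₀ hC
              (s := s))
            (pairSmall₁ F E c N M₁ e₁ JV J₁ s₁) (pairSmall₂ F E c N M₂ e₂ JV J₂ s₂)
            (hs₃_seesawConj F E c N M₁ M₂ eW e₁ e₂ JV JW J₁ J₂ hcδ hδ hd hV hW h₁ h₂ hVd hTWd h₁d h₂d hT hJV hJW hJ₁ hJ₂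
              hgg₀ hg hCC₀ hC hs hs₁ hs₂)
            (isUnit_kronecker_map F N hVd h₁d) (isUnit_kronecker_map F N hVd h₂d))
          ((adelicMpCont.omega F (Fin N × Fin M₂)
            (TV.map (algebraMap F (AdeleRing (𝓞 F) F)) ⊗ₖ T₂.map (algebraMap F (AdeleRing (𝓞 F) F)))).comp
            (pairSmall₂ F E c N M₂ e₂ JV J₂ s₂)) (v, u₂) Φ₂) :=
  mpSeesaw_tensorToSum_twist_small _ _ _
    (hs₃_seesawConj F E c N M₁ M₂ eW e₁ e₂ JV JW J₁ J₂ hcδ hδ hd hV hW h₁ h₂ hVd hTWd h₁d h₂d hT hJV hJW hJ₁ hJ₂ hgg₀ hg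
      hCC₀ hC hs hs₁ hs₂) _ _ v u₁ u₂ Φ₁ Φ₂

include hs in
/-- `Θ`-fixing at rational points of the conjugated splitting in block-sum coordinates (range form; `g` rational).
[cite: Weil1964, Chap. III n° 41 Thm 6 p. 193] -/
theorem coe_seesawConjSum_mem_adelicMpTheta
    (hg₀ : (((g₀ : GL (Fin (M₁ + M₂)) E) : Matrix (Fin (M₁ + M₂)) (Fin (M₁ + M₂)) E).map (c : E →+* E))ᵀ * JW * g₀ =
      finSum M₁ M₂ J₁ J₂)
    {v : adelic F E c N JV} (hv : v ∈ (toAdelic F E c N JV).range)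
    {u₁ : adelic F E c M₁ J₁} (hu₁ : u₁ ∈ (toAdelic F E c M₁ J₁).range)
    {u₂ : adelic F E c M₂ J₂} (hu₂ : u₂ ∈ (toAdelic F E c M₂ J₂).range) :
    ((seesawConjSum F E c N M₁ M₂ eW JV JW J₁ J₂ hcδ hδ hd hV hW h₁ h₂ hVd hTWd hT hJV hJW hJ₁ hJ₂ hgg₀ hg hCC₀ hC
        (s := s) (v, (u₁, u₂)) : adelicMpCont F _ _) : adelicMp F _ _) ∈
      adelicMpTheta F ((Fin N × Fin M₁) ⊕ (Fin N × Fin M₂))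
        (Matrix.fromBlocks (TV.map (algebraMap F (AdeleRing (𝓞 F) F)) ⊗ₖ T₁.map (algebraMap F (AdeleRing (𝓞 F) F))) 0 0
          (TV.map (algebraMap F (AdeleRing (𝓞 F) F)) ⊗ₖ T₂.map (algebraMap F (AdeleRing (𝓞 F) F)))) := by
  obtain ⟨γV, rfl⟩ := hv
  obtain ⟨γ₁, rfl⟩ := hu₁
  obtain ⟨γ₂, rfl⟩ := hu₂
  exact (sumSeesawSplitting_mem_adelicMpTheta_iff (finProdSumEquiv N M₁ M₂) (reindex_gram_finSum F N M₁ M₂) _ _).2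
    (coe_seesawConjSplitting_mem_adelicMpTheta F E c N M₁ M₂ eW JV JW J₁ J₂ hcδ hδ hd hV hW h₁ h₂ hVd hTWd hT hJV hJW
      hJ₁ hJ₂ hgg₀ hg hCC₀ hC hs hg₀ γV γ₁ γ₂)

/-- **`λ_V′ = 1` on `U(J_V)(F)`** (automorphic; `g` rational). [cite: Weil1964, Chap. III n° 41 Thm 6 p. 193] -/
theorem charV₃₄_eq_one_of_rational
    (hg₀ : (((g₀ : GL (Fin (M₁ + M₂)) E) : Matrix (Fin (M₁ + M₂)) (Fin (M₁ + M₂)) E).map (c : E →+* E))ᵀ * JW * g₀ =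
      finSum M₁ M₂ J₁ J₂)
    {v : adelic F E c N JV} (hv : v ∈ (toAdelic F E c N JV).range) :
    charV₃₄ F E c N M₁ M₂ eW e₁ e₂ JV JW J₁ J₂ hcδ hδ hd hV hW h₁ h₂ hVd hTWd h₁d h₂d hT hJV hJW hJ₁ hJ₂ hgg₀ hg hCC₀ hC
        hs hs₁ hs₂ v = 1 :=
  mpCharV_eq_one_of_mem_adelicMpTheta _ _ _
    (hs₃_seesawConj F E c N M₁ M₂ eW e₁ e₂ JV JW J₁ J₂ hcδ hδ hd hV hW h₁ h₂ hVd hTWd h₁d h₂d hT hJV hJW hJ₁ hJ₂ hgg₀ hg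
      hCC₀ hC hs hs₁ hs₂) _ _
    (coe_seesawConjSum_mem_adelicMpTheta F E c N M₁ M₂ eW JV JW J₁ J₂ hcδ hδ hd hV hW h₁ h₂ hVd hTWd hT hJV hJW hJ₁ hJ₂
      hgg₀ hg hCC₀ hC hs hg₀ hv (one_mem _) (one_mem _))
    (coe_pairSmall₁_mem_adelicMpTheta F E c N M₁ e₁ JV J₁ hcδ hδ hd hV h₁ hVd h₁d hJV hJ₁ hs₁ hv (one_mem _))
    (coe_pairSmall₂_mem_adelicMpTheta F E c N M₂ e₂ JV J₂ hcδ hδ hd hV h₂ hVd h₂d hJV hJ₂ hs₂ hv (one_mem _))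

/-! ### Read-back of the block-sum theta functional, `(34)` -/

/-- **the block-sum theta functional of the CONJUGATED torus is the big pair's at a transformed test function**:
`Θ(ω(seesawConjSum (v,(u₁,u₂))) Ψ) = Θ(ω(s_pair(v, g (u₁ ⊕ᶠ u₂) g⁻¹)) (R_{e_W} (ω(r_F h₀) (R_f⁻¹ Ψ))))` — `r_F(h₀)` fixes
`Θ`, then the transport-back identity of `ratConjSplitting` and the reindexing invariance of `Θ`.
[cite: Weil1964, Chap. III n° 41 Thm 6 p. 193] -/
theorem thetaDistLM_omega_seesawConjSum (p : adelic F E c N JV × (adelic F E c M₁ J₁ × adelic F E c M₂ J₂))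
    (Ψ : piSchwartzBruhat F ((Fin N × Fin M₁) ⊕ (Fin N × Fin M₂))) :
    thetaDistLM F ((Fin N × Fin M₁) ⊕ (Fin N × Fin M₂))
        (adelicMpCont.omega F ((Fin N × Fin M₁) ⊕ (Fin N × Fin M₂))
          (Matrix.fromBlocks (TV.map (algebraMap F (AdeleRing (𝓞 F) F)) ⊗ₖ T₁.map (algebraMap F (AdeleRing (𝓞 F) F))) 0 0
            (TV.map (algebraMap F (AdeleRing (𝓞 F) F)) ⊗ₖ T₂.map (algebraMap F (AdeleRing (𝓞 F) F))))
          (seesawConjSum F E c N M₁ M₂ eW JV JW J₁ J₂ hcδ hδ hd hV hW h₁ h₂ hVd hTWd hT hJV hJW hJ₁ hJ₂ hgg₀ hg hCC₀ hC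
            (s := s) p) Ψ) =
      thetaDistLM F (Fin n)
        (adelicMpCont.omega F (Fin n) (adelicGram F eW TV TW)
          (pairSplitting F E c N (M₁ + M₂) eW JV JW s
            (p.1, adelicIsometryConj F E c (M₁ + M₂) g hg (adelicBlockDiag F E c M₁ M₂ J₁ J₂ p.2)))
          (piSBReindex F eW
            (adelicMpCont.omega F (Fin N × Fin (M₁ + M₂))
              (TV.map (algebraMap F (AdeleRing (𝓞 F) F)) ⊗ₖ TW.map (algebraMap F (AdeleRing (𝓞 F) F)))
              (ratPointsThetaLiftCont F (Fin N × Fin (M₁ + M₂)) _ hT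
                ⟨seesawElement F E c N M₁ M₂ JV JW J₁ J₂ hcδ hδ hd hV hW h₁ h₂ hJV hJW hJ₁ hJ₂ hg hC,
                  seesawElement_mem_range F E c N M₁ M₂ JV JW J₁ J₂ hcδ hδ hd hV hW h₁ h₂ hVd hTWd hT hJV hJW hJ₁ hJ₂ hgg₀
                    hg hCC₀ hC⟩)
              ((piSBReindex F (finProdSumEquiv N M₁ M₂)).symm Ψ)))) :=
  (congrArg (thetaDistLM F ((Fin N × Fin M₁) ⊕ (Fin N × Fin M₂)))
      (omega_sumSeesawSplitting_apply (finProdSumEquiv N M₁ M₂) (reindex_gram_finSum F N M₁ M₂) _ p Ψ)).trans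
    ((thetaDistLM_piSBReindex F (finProdSumEquiv N M₁ M₂) _).trans
      (((thetaDistLM_omega_of_mem_adelicMpTheta
            (coe_ratPointsThetaLiftCont_mem_adelicMpTheta F (Fin N × Fin (M₁ + M₂)) _ hT
              ⟨seesawElement F E c N M₁ M₂ JV JW J₁ J₂ hcδ hδ hd hV hW h₁ h₂ hJV hJW hJ₁ hJ₂ hg hC,
                seesawElement_mem_range F E c N M₁ M₂ JV JW J₁ J₂ hcδ hδ hd hV hW h₁ h₂ hVd hTWd hT hJV hJW hJ₁ hJ₂ hgg₀
                  hg hCC₀ hC⟩) _).symm.trans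
          (congrArg (thetaDistLM F (Fin N × Fin (M₁ + M₂)))
            (omega_apply_omega_ratConjSplitting F (Fin N × Fin (M₁ + M₂)) hT
              (seesawElement F E c N M₁ M₂ JV JW J₁ J₂ hcδ hδ hd hV hW h₁ h₂ hJV hJW hJ₁ hJ₂ hg hC)
              (seesawElement_mem_range F E c N M₁ M₂ JV JW J₁ J₂ hcδ hδ hd hV hW h₁ h₂ hVd hTWd hT hJV hJW hJ₁ hJ₂ hgg₀
                hg hCC₀ hC)
              C hC (seesawBigConj F E c N M₁ M₂ eW JV JW J₁ J₂ s g hg) p _))).trans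
        ((congrArg (thetaDistLM F (Fin N × Fin (M₁ + M₂)))
            (omega_seesawBigConj_apply F E c N M₁ M₂ eW JV JW J₁ J₂ s g hg p _)).trans
          (thetaDistLM_piSBReindex F eW.symm _))))

end ThirtyFour

end UnitaryDualPair

end Literature.NumberTheory.GelbartRogawski1991

end

/-! ### Build-lane note (ops-buildfix G11b-3 recipe v2, LEDGER B13-1/B14-5/B14-7, 2026-08-22)
`lean -o` (the hub build lane, never `lean`/the gate check) runs Lean 4.32's library-suggestion indexers
(`Lean.LibrarySuggestions.SymbolFrequency` / `SineQuaNon`, from their `exportEntriesFn`) over the statement of every local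
theorem constant that is not a denied premise; on this family's statements (very large dependent binder telescopes) that fold
runs for tens of minutes (incident G11b-3, run/shared/lean/ops/buildfix/G11b-3-DOSSIER.md). `isDeniedPremise` skips
`[implicit_reducible]` constants before any fold, and the status is inert on theorems (Meta never unfolds `thmInfo`).
v2 form: ONE file-final, top-level `local` attribute — it goes through the synchronous scoped reducibility extension that
`getReducibilityStatusCore` reads first, so it needs no `set_option Elab.async false` (parallel elaboration stays on), also
reaches auto-realized `*.congr_simp` / structure-projection theorem constants, is never popped before export, and is not
exported. No statement or proof is changed. -/
set_option allowUnsafeReducibility true in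
attribute [local implicit_reducible]
  Literature.NumberTheory.GelbartRogawski1991.UnitaryDualPair.seesawSmall₁_eq
  Literature.NumberTheory.GelbartRogawski1991.UnitaryDualPair.seesawSmall₂_eq
  Literature.NumberTheory.GelbartRogawski1991.UnitaryDualPair.continuous_pairSmall₁
  Literature.NumberTheory.GelbartRogawski1991.UnitaryDualPair.continuous_pairSmall₂
  Literature.NumberTheory.GelbartRogawski1991.UnitaryDualPair.seesawBigSum_def
  Literature.NumberTheory.GelbartRogawski1991.UnitaryDualPair.continuous_seesawBigSum
  Literature.NumberTheory.GelbartRogawski1991.UnitaryDualPair.hs₃_seesaw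
  Literature.NumberTheory.GelbartRogawski1991.UnitaryDualPair.restrictTmul₁₂
  Literature.NumberTheory.GelbartRogawski1991.UnitaryDualPair.coe_seesawBigSum_mem_adelicMpTheta
  Literature.NumberTheory.GelbartRogawski1991.UnitaryDualPair.coe_pairSmall₁_mem_adelicMpTheta
  Literature.NumberTheory.GelbartRogawski1991.UnitaryDualPair.coe_pairSmall₂_mem_adelicMpTheta
  Literature.NumberTheory.GelbartRogawski1991.UnitaryDualPair.charV₁₂_eq_one_of_rational
  Literature.NumberTheory.GelbartRogawski1991.UnitaryDualPair.char₁_eq_one_of_rational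
  Literature.NumberTheory.GelbartRogawski1991.UnitaryDualPair.char₂_eq_one_of_rational
  Literature.NumberTheory.GelbartRogawski1991.UnitaryDualPair.continuous_charV₁₂
  Literature.NumberTheory.GelbartRogawski1991.UnitaryDualPair.continuous_char₁
  Literature.NumberTheory.GelbartRogawski1991.UnitaryDualPair.continuous_char₂
  Literature.NumberTheory.GelbartRogawski1991.UnitaryDualPair.omega_seesawBigSum_apply
  Literature.NumberTheory.GelbartRogawski1991.UnitaryDualPair.thetaDistLM_omega_seesawBigSum
  Literature.NumberTheory.GelbartRogawski1991.UnitaryDualPair.seesawConjSum_def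
  Literature.NumberTheory.GelbartRogawski1991.UnitaryDualPair.hs₃_seesawConj
  Literature.NumberTheory.GelbartRogawski1991.UnitaryDualPair.restrictTmul₃₄
  Literature.NumberTheory.GelbartRogawski1991.UnitaryDualPair.coe_seesawConjSum_mem_adelicMpTheta
  Literature.NumberTheory.GelbartRogawski1991.UnitaryDualPair.charV₃₄_eq_one_of_rational
  Literature.NumberTheory.GelbartRogawski1991.UnitaryDualPair.thetaDistLM_omega_seesawConjSum
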